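import Mathlib.Analysis.InnerProductSpace.PiL2
import Mathlib.Analysis.Normed.Group.Bounded
import Mathlib.Topology.MetricSpace.ProperSpace.Real
import HarnessLib

/-!
# Crux `BlockLipschitzL` (stmt-QuantumFields-23533) ∕ `HistoryTailL` (stmt-QuantumFields-19936), LINE 25 «CompactnessTransfer»,
# K2 continuum face, row (RS) `MinimisingMapSmoothness` — FILE (RS-a)-letters «THE SECOND-ORDER EXPANSION OF THE NORMALISED
# OUTER VARIATION, AS PURE ALGEBRA»

Cell `ym3-torus` (YM ladder rung R3 = continuum SU(2) Yang–Mills on T³ — a RUNG, NOT the Clay problem: not d = 4, not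
infinite volume, not a mass gap); WIDTH helper seat `ym-ust-19936-w7` g14 (LEAD ★w1-19936 g10 2026-08-29T14:39:36Z «(RS-a) at own
risk, helper class, keep it limit-free»).  THEOREMS ONLY (0 `def`, 0 `sorry`, default heartbeats); Mathlib only.

THE OBJECT.  For a unit Sobolev map `U` with weak gradient `G` (tangential: `⟪U, G eᵢ⟫ = 0`) the outer variation
`W_t := N(U + t ζ e)` (`N` the normalisation `y ↦ y∕‖y‖`, `e` a unit vector, `ζ` a test function) has, at a point, the energy
density `Σᵢ ‖DN(Y)(G eᵢ + t ∂ᵢζ e)‖²`, `Y = U + tζe`, and `‖DN(Y)h‖² = (‖Y‖²‖h‖² − ⟪Y,h⟫²)∕‖Y‖⁴`.  In the scalars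
`b := ⟪U,e⟫`, `c := ⟪G eᵢ, e⟫`, `g := ‖G eᵢ‖²`, `a := ∂ᵢζ`, `ζ` (the value) this is the rational function
`q(t) = (D·H − K²)∕D²`, `D = 1 + 2tζb + t²ζ²`, `H = g + 2tac + t²a²`, `K = t(ab + ζc) + t²ζa`.
THIS FILE: the EXACT identity `D·H − K² − (g + t·q₁ + t²·q₂)·D² = t³·(g·A + c²·B + ac·C + a²·E)` with
`q₁ = 2(ac − ζbg)`, `q₂ = a²(1 − b²) − 6ζabc − ζ²g − ζ²c² + 4ζ²b²g` and four explicit polynomials `A, B, C, E` in `(t, b, ζ)`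
(★ `expansion_identity`, `ring`); a UNIFORM bound `|A|,|B|,|C|,|E| ≤ S` on `[−1,1]³` by compactness (★ `exists_coeff_bound`); the
resulting one-sided second-order bound ★★ `density_le_expansion`: for `|t| ≤ ¼`, `|b| ≤ 1`, `|ζ| ≤ 1`, `c² ≤ g`,
`(D·H − K²)∕D² ≤ g + t·q₁ + t²·q₂ + |t|³·S′·(g + a²)`; and the orthonormal-basis sums ★ `sum_q₂_eq`:
`Σ_e q₂(e) = (n − 1)·a² − (n − 3)·ζ²·g` (`Σ_e b_e² = 1`, `Σ_e c_e² = g`, `Σ_e b_e c_e = ⟪U, G eᵢ⟫ = 0`, `n = dim`) — the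
pointwise heart of the stability inequality `(n − 3)∫ζ²|∇U|² ≤ (n − 1)∫|∇ζ|²` of [SchoenUhlenbeck1984, (1.3)–(1.5)] for
energy-minimising maps into `S^{n−1}`.
HONEST SCOPE.  Real algebra; nothing of (RS), (C), S1″, K1, `MeanDeviationL`, `BlockLipschitzL`, `HistoryTailL` is proved here;
YM₃ on T³ is rung R3, not Clay; YM gap NOT proved; no summit statement is proved here.

References: R. Schoen, K. Uhlenbeck, Regularity of minimizing harmonic maps into the sphere, Invent. Math. 78 (1984) 89–100
[SchoenUhlenbeck1984] (§1, the second variation of energy for sphere-valued maps summed over the coordinate directions);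
L. Simon, Theorems on Regularity and Singularity of Energy Minimizing Maps (1996) [Simon1996] (§2.2).
-/

set_option autoImplicit false

noncomputable section

open scoped RealInnerProductSpace BigOperators

namespace Summit.QuantumFields.YangMills.Theorems.PoincareLipschitzMinimiserStabilityLetters

/-! ## §1 The exact expansion of the normalised density to second order -/

/-- ★ **THE EXPANSION IDENTITY** (pure `ring`): with `D = 1 + 2tζb + t²ζ²`, `H = g + 2tac + t²a²`, `K = t(ab + ζc) + t²ζa`,
`q₁ = 2(ac − ζbg)`, `q₂ = a²(1−b²) − 6ζabc − ζ²g − ζ²c² + 4ζ²b²g`: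
`D·H − K² − (g + t·q₁ + t²·q₂)·D² = t³·(g·A + c²·B + (ac)·C + a²·E)` for the four displayed polynomials `A, B, C, E` in
`(t, b, ζ)`. [cite: SchoenUhlenbeck1984, §1 (1.3)] -/
theorem expansion_identity (t a b c ζ g : ℝ) :
    (1 + 2 * t * ζ * b + t ^ 2 * ζ ^ 2) * (g + 2 * t * a * c + t ^ 2 * a ^ 2) - (t * (a * b + ζ * c) + t ^ 2 * ζ * a) ^ 2
      - (g + t * (2 * (a * c - ζ * b * g)) +
          t ^ 2 * (a ^ 2 * (1 - b ^ 2) - 6 * ζ * a * b * c - ζ ^ 2 * g - ζ ^ 2 * c ^ 2 + 4 * ζ ^ 2 * b ^ 2 * g)) *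
        (1 + 2 * t * ζ * b + t ^ 2 * ζ ^ 2) ^ 2 =
    t ^ 3 * (g * (4*b*ζ^3 - 8*b^3*ζ^3 + t*ζ^4 + 4*t*b^2*ζ^4 - 16*t*b^4*ζ^4 + 6*t^2*b*ζ^5 - 16*t^2*b^3*ζ^5 + t^3*ζ^6
              - 4*t^3*b^2*ζ^6) +
      c ^ 2 * (4*b*ζ^3 + 2*t*ζ^4 + 4*t*b^2*ζ^4 + 4*t^2*b*ζ^5 + t^3*ζ^6) +
      (a * c) * (- 4*ζ^2 + 16*b^2*ζ^2 + 4*t*b*ζ^3 + 24*t*b^3*ζ^3 - 2*t^2*ζ^4 + 24*t^2*b^2*ζ^4 + 6*t^3*b*ζ^5) +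
      a ^ 2 * (- 4*b*ζ + 4*b^3*ζ - 2*t*ζ^2 - 2*t*b^2*ζ^2 + 4*t*b^4*ζ^2 - 4*t^2*b*ζ^3 + 4*t^2*b^3*ζ^3 - t^3*ζ^4
              + t^3*b^2*ζ^4)) := by
  ring

/-- ★ **UNIFORM COEFFICIENT BOUND** on the cube `|t|, |b|, |ζ| ≤ 1`: one `S ≥ 0` dominating `|A|`, `|B|`, `|C|`, `|E|`
(continuity on a compact set — no hand-summed constants). [folklore] -/
theorem exists_coeff_bound :
    ∃ S : ℝ, 0 ≤ S ∧ ∀ t b ζ : ℝ, |t| ≤ 1 → |b| ≤ 1 → |ζ| ≤ 1 →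
      |4*b*ζ^3 - 8*b^3*ζ^3 + t*ζ^4 + 4*t*b^2*ζ^4 - 16*t*b^4*ζ^4 + 6*t^2*b*ζ^5 - 16*t^2*b^3*ζ^5 + t^3*ζ^6
          - 4*t^3*b^2*ζ^6| ≤ S ∧
      |4*b*ζ^3 + 2*t*ζ^4 + 4*t*b^2*ζ^4 + 4*t^2*b*ζ^5 + t^3*ζ^6| ≤ S ∧
      |(- 4*ζ^2 + 16*b^2*ζ^2 + 4*t*b*ζ^3 + 24*t*b^3*ζ^3 - 2*t^2*ζ^4 + 24*t^2*b^2*ζ^4 + 6*t^3*b*ζ^5)| ≤ S ∧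
      |(- 4*b*ζ + 4*b^3*ζ - 2*t*ζ^2 - 2*t*b^2*ζ^2 + 4*t*b^4*ζ^2 - 4*t^2*b*ζ^3 + 4*t^2*b^3*ζ^3 - t^3*ζ^4
          + t^3*b^2*ζ^4)| ≤ S := by
  -- the four polynomials as continuous functions on `ℝ × ℝ × ℝ`, bounded on the compact cube
  set K : Set (ℝ × ℝ × ℝ) := Set.Icc (-1) 1 ×ˢ (Set.Icc (-1) 1 ×ˢ Set.Icc (-1) 1) with hK
  have hKc : IsCompact K := isCompact_Icc.prod (isCompact_Icc.prod isCompact_Icc)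
  set fA : ℝ × ℝ × ℝ → ℝ := fun p => 4*p.2.1*p.2.2^3 - 8*p.2.1^3*p.2.2^3 + p.1*p.2.2^4 + 4*p.1*p.2.1^2*p.2.2^4
      - 16*p.1*p.2.1^4*p.2.2^4 + 6*p.1^2*p.2.1*p.2.2^5 - 16*p.1^2*p.2.1^3*p.2.2^5 + p.1^3*p.2.2^6
      - 4*p.1^3*p.2.1^2*p.2.2^6 with hfA
  set fB : ℝ × ℝ × ℝ → ℝ := fun p => 4*p.2.1*p.2.2^3 + 2*p.1*p.2.2^4 + 4*p.1*p.2.1^2*p.2.2^4 + 4*p.1^2*p.2.1*p.2.2^5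
      + p.1^3*p.2.2^6 with hfB
  set fC : ℝ × ℝ × ℝ → ℝ := fun p => - 4*p.2.2^2 + 16*p.2.1^2*p.2.2^2 + 4*p.1*p.2.1*p.2.2^3 + 24*p.1*p.2.1^3*p.2.2^3
      - 2*p.1^2*p.2.2^4 + 24*p.1^2*p.2.1^2*p.2.2^4 + 6*p.1^3*p.2.1*p.2.2^5 with hfC
  set fE : ℝ × ℝ × ℝ → ℝ := fun p => - 4*p.2.1*p.2.2 + 4*p.2.1^3*p.2.2 - 2*p.1*p.2.2^2 - 2*p.1*p.2.1^2*p.2.2^2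
      + 4*p.1*p.2.1^4*p.2.2^2 - 4*p.1^2*p.2.1*p.2.2^3 + 4*p.1^2*p.2.1^3*p.2.2^3 - p.1^3*p.2.2^4
      + p.1^3*p.2.1^2*p.2.2^4 with hfE
  have hcA : Continuous fA := by simp only [hfA]; fun_prop
  have hcB : Continuous fB := by simp only [hfB]; fun_prop
  have hcC : Continuous fC := by simp only [hfC]; fun_prop
  have hcE : Continuous fE := by simp only [hfE]; fun_prop
  obtain ⟨SA, hSA⟩ := hKc.exists_bound_of_continuousOn hcA.continuousOn
  obtain ⟨SB, hSB⟩ := hKc.exists_bound_of_continuousOn hcB.continuousOn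
  obtain ⟨SC, hSC⟩ := hKc.exists_bound_of_continuousOn hcC.continuousOn
  obtain ⟨SE, hSE⟩ := hKc.exists_bound_of_continuousOn hcE.continuousOn
  have h0 : (0 : ℝ × ℝ × ℝ) ∈ K := by
    simp only [hK, Set.mem_prod, Set.mem_Icc, Prod.fst_zero, Prod.snd_zero]
    norm_num
  have hSA0 : 0 ≤ SA := (norm_nonneg _).trans (hSA 0 h0)
  have hSB0 : 0 ≤ SB := (norm_nonneg _).trans (hSB 0 h0)
  have hSC0 : 0 ≤ SC := (norm_nonneg _).trans (hSC 0 h0)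
  have hSE0 : 0 ≤ SE := (norm_nonneg _).trans (hSE 0 h0)
  refine ⟨SA + SB + SC + SE, by positivity, fun t b ζ ht hb hζ => ?_⟩
  have hmem : ((t, b, ζ) : ℝ × ℝ × ℝ) ∈ K := by
    simp only [hK, Set.mem_prod, Set.mem_Icc]
    exact ⟨abs_le.mp ht, abs_le.mp hb, abs_le.mp hζ⟩
  have eA := hSA _ hmem
  have eB := hSB _ hmem
  have eC := hSC _ hmem
  have eE := hSE _ hmem
  simp only [hfA, hfB, hfC, hfE, Real.norm_eq_abs] at eA eB eC eE
  refine ⟨eA.trans (by linarith), eB.trans (by linarith), eC.trans (by linarith), eE.trans (by linarith)⟩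

/-- **Abstract remainder bound**: `|g·A + c²·B + ac·C + a²·E| ≤ 3S₀(g + a²)` when `|A|,|B|,|C|,|E| ≤ S₀`, `0 ≤ g`, `c² ≤ g`.
[folklore] -/
theorem abs_remainder_le {g a c A B C E S₀ : ℝ} (hg : 0 ≤ g) (hcg : c ^ 2 ≤ g) (hS₀ : 0 ≤ S₀)
    (hA : |A| ≤ S₀) (hB : |B| ≤ S₀) (hC : |C| ≤ S₀) (hE : |E| ≤ S₀) :
    |g * A + c ^ 2 * B + (a * c) * C + a ^ 2 * E| ≤ 3 * S₀ * (g + a ^ 2) := by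
  have hac : |a * c| ≤ (a ^ 2 + g) / 2 := by
    rw [abs_mul]
    nlinarith [sq_nonneg (|a| - |c|), sq_abs a, sq_abs c, abs_nonneg a, abs_nonneg c]
  have h1 : |g * A| ≤ g * S₀ := by rw [abs_mul, abs_of_nonneg hg]; exact mul_le_mul_of_nonneg_left hA hg
  have h2 : |c ^ 2 * B| ≤ g * S₀ := by
    rw [abs_mul, abs_of_nonneg (sq_nonneg c)]
    exact (mul_le_mul_of_nonneg_left hB (sq_nonneg c)).trans (mul_le_mul_of_nonneg_right hcg hS₀)
  have h3 : |a * c * C| ≤ (a ^ 2 + g) / 2 * S₀ := by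
    rw [abs_mul]
    exact mul_le_mul hac hC (abs_nonneg _) (by positivity)
  have h4 : |a ^ 2 * E| ≤ a ^ 2 * S₀ := by
    rw [abs_mul, abs_of_nonneg (sq_nonneg a)]; exact mul_le_mul_of_nonneg_left hE (sq_nonneg a)
  have h5 : |g * A + c ^ 2 * B + (a * c) * C + a ^ 2 * E| ≤ g * S₀ + g * S₀ + (a ^ 2 + g) / 2 * S₀ + a ^ 2 * S₀ :=
    calc |g * A + c ^ 2 * B + (a * c) * C + a ^ 2 * E|
        ≤ |g * A + c ^ 2 * B + (a * c) * C| + |a ^ 2 * E| := abs_add_le _ _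
      _ ≤ (|g * A + c ^ 2 * B| + |a * c * C|) + |a ^ 2 * E| := by gcongr; exact abs_add_le _ _
      _ ≤ (|g * A| + |c ^ 2 * B| + |a * c * C|) + |a ^ 2 * E| := by gcongr; exact abs_add_le _ _
      _ ≤ (g * S₀ + g * S₀ + (a ^ 2 + g) / 2 * S₀) + a ^ 2 * S₀ := by gcongr
  have h6 : 0 ≤ g * S₀ := mul_nonneg hg hS₀
  have h7 : 0 ≤ a ^ 2 * S₀ := mul_nonneg (sq_nonneg a) hS₀
  linarith

/-- **Abstract division step**: if `N − M·D² = t³·R`, `¼ ≤ D²`, `|R| ≤ 3S₀(g + a²)` then `N∕D² ≤ M + |t|³·(12S₀)·(g + a²)`.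
[folklore] -/
theorem div_le_of_expansion {N M D R t S₀ g a : ℝ} (hD2 : 1 / 4 ≤ D ^ 2) (hid : N - M * D ^ 2 = t ^ 3 * R)
    (hS₀ : 0 ≤ S₀) (hg : 0 ≤ g) (hR : |R| ≤ 3 * S₀ * (g + a ^ 2)) :
    N / D ^ 2 ≤ M + |t| ^ 3 * (12 * S₀) * (g + a ^ 2) := by
  have hD2pos : 0 < D ^ 2 := by linarith
  have hN : N = M * D ^ 2 + t ^ 3 * R := by linarith
  rw [hN, add_div, mul_div_cancel_right₀ _ hD2pos.ne', add_le_add_iff_left, div_le_iff₀ hD2pos]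
  have h1 : t ^ 3 * R ≤ |t| ^ 3 * (3 * S₀ * (g + a ^ 2)) := by
    have h2 : |t ^ 3 * R| ≤ |t| ^ 3 * (3 * S₀ * (g + a ^ 2)) := by
      rw [abs_mul, abs_pow]; exact mul_le_mul_of_nonneg_left hR (by positivity)
    exact (le_abs_self _).trans h2
  have h3 : 0 ≤ |t| ^ 3 * (3 * S₀ * (g + a ^ 2)) := by positivity
  nlinarith

/-- ★★ **THE ONE-SIDED SECOND-ORDER BOUND.**  There is a universal `S ≥ 0` with: for `|t| ≤ ¼`, `|b| ≤ 1`, `|ζ| ≤ 1`, `0 ≤ g`,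
`c² ≤ g`,
`(D·H − K²)∕D² ≤ g + t·q₁ + t²·q₂ + |t|³·S·(g + a²)`
(`D ≥ ½` on this range; `|g·A + c²·B + ac·C + a²·E| ≤ S₀·(g + c² + |a||c| + a²) ≤ 3S₀(g + a²)`).
[cite: SchoenUhlenbeck1984, §1 (1.3)] -/
theorem density_le_expansion :
    ∃ S : ℝ, 0 ≤ S ∧ ∀ t a b c ζ g : ℝ, |t| ≤ 1 / 4 → |b| ≤ 1 → |ζ| ≤ 1 → 0 ≤ g → c ^ 2 ≤ g →
      ((1 + 2 * t * ζ * b + t ^ 2 * ζ ^ 2) * (g + 2 * t * a * c + t ^ 2 * a ^ 2) - (t * (a * b + ζ * c) + t ^ 2 * ζ * a) ^ 2) /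
          (1 + 2 * t * ζ * b + t ^ 2 * ζ ^ 2) ^ 2 ≤
        g + t * (2 * (a * c - ζ * b * g)) +
          t ^ 2 * (a ^ 2 * (1 - b ^ 2) - 6 * ζ * a * b * c - ζ ^ 2 * g - ζ ^ 2 * c ^ 2 + 4 * ζ ^ 2 * b ^ 2 * g) +
          |t| ^ 3 * S * (g + a ^ 2) := by
  obtain ⟨S₀, hS₀, hS⟩ := exists_coeff_bound
  refine ⟨12 * S₀, by positivity, fun t a b c ζ g ht hb hζ hg hcg => ?_⟩
  have ht1 : |t| ≤ 1 := ht.trans (by norm_num)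
  obtain ⟨hA, hB, hC, hE⟩ := hS t b ζ ht1 hb hζ
  -- `D ≥ 1/2`
  have htb : |t * ζ * b| ≤ 1 / 4 := by
    rw [abs_mul, abs_mul]
    have h1 : |t| * |ζ| ≤ 1 / 4 * 1 := mul_le_mul ht hζ (abs_nonneg _) (by norm_num)
    calc |t| * |ζ| * |b| ≤ 1 / 4 * 1 * 1 := mul_le_mul h1 hb (abs_nonneg _) (by norm_num)
      _ = 1 / 4 := by norm_num
  have hD12 : 1 / 2 ≤ 1 + 2 * t * ζ * b + t ^ 2 * ζ ^ 2 := by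
    have h1 := (abs_le.mp htb).1
    have h2 : 0 ≤ t ^ 2 * ζ ^ 2 := by positivity
    linarith
  have hD2 : 1 / 4 ≤ (1 + 2 * t * ζ * b + t ^ 2 * ζ ^ 2) ^ 2 := by nlinarith
  exact div_le_of_expansion hD2 (expansion_identity t a b c ζ g) hS₀ hg (abs_remainder_le hg hcg hS₀ hA hB hC hE)

/-! ## §2 The orthonormal-basis sums -/

/-- ★ **SUMMING THE SECOND-ORDER COEFFICIENT OVER AN ORTHONORMAL BASIS.**  For an orthonormal basis `e` of a real
inner-product space of dimension `n`, a unit vector `u` and a vector `w ⊥ u`: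
`Σ_k [a²(1 − ⟪u,e_k⟫²) − 6ζa⟪u,e_k⟫⟪w,e_k⟫ − ζ²‖w‖² − ζ²⟪w,e_k⟫² + 4ζ²⟪u,e_k⟫²‖w‖²] = (n − 1)·a² − (n − 3)·ζ²·‖w‖²`
(Parseval: `Σ⟪u,e_k⟫² = 1`, `Σ⟪w,e_k⟫² = ‖w‖²`, `Σ⟪u,e_k⟫⟪w,e_k⟫ = ⟪u,w⟫ = 0`). [cite: SchoenUhlenbeck1984, §1 (1.4)] -/
theorem sum_q₂_eq {F : Type*} [NormedAddCommGroup F] [InnerProductSpace ℝ F] {ι : Type*} [Fintype ι]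
    (e : OrthonormalBasis ι ℝ F) {u w : F} (hu : ‖u‖ = 1) (huw : ⟪u, w⟫ = 0) (a ζ : ℝ) :
    ∑ k, (a ^ 2 * (1 - ⟪u, e k⟫ ^ 2) - 6 * ζ * a * ⟪u, e k⟫ * ⟪w, e k⟫ - ζ ^ 2 * ‖w‖ ^ 2 - ζ ^ 2 * ⟪w, e k⟫ ^ 2 +
        4 * ζ ^ 2 * ⟪u, e k⟫ ^ 2 * ‖w‖ ^ 2) =
      ((Fintype.card ι : ℝ) - 1) * a ^ 2 - ((Fintype.card ι : ℝ) - 3) * ζ ^ 2 * ‖w‖ ^ 2 := by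
  have h1 : ∑ k, ⟪u, e k⟫ ^ 2 = 1 := by
    have := e.sum_inner_mul_inner u u
    rw [real_inner_self_eq_norm_sq, hu, one_pow] at this
    rw [← this]
    exact Finset.sum_congr rfl fun k _ => by rw [sq, real_inner_comm (e k) u]
  have h2 : ∑ k, ⟪w, e k⟫ ^ 2 = ‖w‖ ^ 2 := by
    have := e.sum_inner_mul_inner w w
    rw [real_inner_self_eq_norm_sq] at this
    rw [← this]
    exact Finset.sum_congr rfl fun k _ => by rw [sq, real_inner_comm (e k) w]
  have h3 : ∑ k, ⟪u, e k⟫ * ⟪w, e k⟫ = 0 := by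
    have := e.sum_inner_mul_inner u w
    rw [huw] at this
    rw [← this]
    exact Finset.sum_congr rfl fun k _ => by rw [real_inner_comm (e k) w]
  have hn : ∑ _k : ι, (1 : ℝ) = Fintype.card ι := by simp
  -- expand the sum linearly
  have hsplit : ∑ k, (a ^ 2 * (1 - ⟪u, e k⟫ ^ 2) - 6 * ζ * a * ⟪u, e k⟫ * ⟪w, e k⟫ - ζ ^ 2 * ‖w‖ ^ 2 -
      ζ ^ 2 * ⟪w, e k⟫ ^ 2 + 4 * ζ ^ 2 * ⟪u, e k⟫ ^ 2 * ‖w‖ ^ 2) =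
      a ^ 2 * ∑ _k : ι, (1 : ℝ) - a ^ 2 * ∑ k, ⟪u, e k⟫ ^ 2 - 6 * ζ * a * ∑ k, ⟪u, e k⟫ * ⟪w, e k⟫ -
        ζ ^ 2 * ‖w‖ ^ 2 * ∑ _k : ι, (1 : ℝ) - ζ ^ 2 * ∑ k, ⟪w, e k⟫ ^ 2 + 4 * ζ ^ 2 * ‖w‖ ^ 2 * ∑ k, ⟪u, e k⟫ ^ 2 := by
    simp only [Finset.mul_sum, ← Finset.sum_sub_distrib, ← Finset.sum_add_distrib]
    exact Finset.sum_congr rfl fun k _ => by ring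
  rw [hsplit, h1, h2, h3, hn]
  ring

/-- **The first-order coefficient, summed**: `Σ_k 2(a⟪w,e_k⟫ − ζ⟪u,e_k⟫g) = 2(a⟪w, Σ_k e_k⟫ − ζ g ⟪u, Σ_k e_k⟫)` — recorded
only to name the linear term; it is NOT claimed to vanish pointwise. [folklore] -/
theorem sum_q₁_eq {F : Type*} [NormedAddCommGroup F] [InnerProductSpace ℝ F] {ι : Type*} [Fintype ι]
    (e : ι → F) (u w : F) (a ζ g : ℝ) :
    ∑ k, 2 * (a * ⟪w, e k⟫ - ζ * ⟪u, e k⟫ * g) = 2 * (a * ⟪w, ∑ k, e k⟫ - ζ * g * ⟪u, ∑ k, e k⟫) := by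
  rw [inner_sum, inner_sum, Finset.mul_sum, Finset.mul_sum, ← Finset.sum_sub_distrib, Finset.mul_sum]
  exact Finset.sum_congr rfl fun k _ => by ring

end Summit.QuantumFields.YangMills.Theorems.PoincareLipschitzMinimiserStabilityLetters

end
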